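import Summits.RiemannHypothesis.RiemannHypothesis.Theorems.WeilGroundStateGroundStatesConvergeToXiZeroSideEulerLagrange
import Summits.RiemannHypothesis.RiemannHypothesis.Theorems.WeilGroundStateGroundStatesConvergeToXiStubEnergyCauchy
import Literature.NumberTheory.LFunctions.WeilWindowSuzukiContinuityProofs
import Literature.NumberTheory.LFunctions.WeilGroundState
import HarnessLib

/-!
# Stub `stub_saturation_of_RH` of the line `Sketch`
(crux `WeilGroundState.GroundStatesConvergeToXi`, item stmt-RiemannHypothesis-1527, rev L8b, W4)

**Under RH the ground energy is the zero-sampling sum of every ground state.**  For a ground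
state `u` of Weil's truncated form at the window `a` (`IsWeilGroundState a u`) and under the
Riemann Hypothesis,
`Σ_ρ m(ρ) |û(ρ)|² = ε(a) = weilGroundEnergy a`,
the series over the non-trivial zeros converging absolutely — the sampling map `T : f ↦ (f̂(ρ))_ρ`
at the zeros satisfies `‖T u‖² = ε(a)`.

Proof.  The inequality `Σ_ρ m(ρ)|û(ρ)|² ≤ ε(a)` (and summability) is the sampling inequality
`summable_order_mul_norm_sq_weilMellin_of_riemannHypothesis` (lead c4).  For the reverse
inequality let `gₙ → u` be the minimising sequence of `u` (`Re Q(gₙ) → ε(a)`, `gₙ → u` in `L²`).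
* Under RH the zero side of a test function `w` is a sum of squares,
  `Re Q(w) = Σ_ρ m(ρ)|ŵ(ρ)|²` (`saturation_hasSum_of_isWeilTest`: explicit formula
  `explicit_formula_holds`, `WeilConverse.hasWeilZeroSide_zeroForm`, and `1 - ρ̄ = ρ` on the line).
* The minimising sequence is Cauchy in energy (`stub_energyCauchy`, W3): given `δ > 0`,
  `Σ_{ρ ∈ S} m(ρ)|ĝₙ(ρ) - ĝₖ(ρ)|² ≤ Re Q(gₙ - gₖ) < δ` for `n, k ≥ N` and every finite `S`; letting
  `k → ∞` termwise (`ĝₖ(ρ) → û(ρ)`, `ConnesVanSuijlekom.tendsto_weilMellin`),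
  `Σ_{ρ ∈ S} m(ρ)|ĝₙ(ρ) - û(ρ)|² ≤ δ`.
* The elementary inequality `|x|² ≤ (1 + η)|y|² + (1 + η⁻¹)|x - y|²` (`η > 0`) summed over `S`
  gives `Σ_{ρ ∈ S} m(ρ)|ĝₙ(ρ)|² ≤ (1 + η) T + (1 + η⁻¹) δ`, `T = Σ_ρ m(ρ)|û(ρ)|²`, hence
  `Re Q(gₙ) ≤ (1 + η) T + (1 + η⁻¹) δ` for `n ≥ N`, and `n → ∞` gives
  `ε(a) ≤ (1 + η) T + (1 + η⁻¹) δ` for all `η, δ > 0`, i.e. `ε(a) ≤ T`.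

Mathlib + proved tree material only; no named fact; no definitions; standard axioms.
-/

set_option linter.dupNamespace false

noncomputable section

open MeasureTheory Complex Filter Set
open scoped Real Topology ComplexConjugate

namespace Summit.RiemannHypothesis.RiemannHypothesis.Theorems.GroundStatesConvergeToXi

open Literature.NumberTheory.LFunctions

/-! ### The zero side of a test function is a sum of squares (under RH) -/

/-- **Under RH, `Re Q(w) = Σ_ρ m(ρ) |ŵ(ρ)|²` for every test function `w`**, the series over the
non-trivial zeros converging absolutely: the zero side `Q(w) = Σ_ρ m(ρ) ŵ(ρ) conj ŵ(1 - ρ̄)`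
(`WeilConverse.hasWeilZeroSide_zeroForm`, `explicit_formula_holds`, absolutely convergent by
`WeilConverse.summable_pairCoeff`) has, on the critical line, the terms `m(ρ)|ŵ(ρ)|²`
(`re_order_mul_pairCoeff_eq_of_re_eq_half`). [folklore] -/
theorem saturation_hasSum_of_isWeilTest (hRH : RiemannHypothesis) {w : ℝ → ℂ}
    (hw : IsWeilTest w) :
    HasSum (fun ρ : ZetaZeros.riemannZetaNontrivialZeros ↦
        (riemannZetaZeroOrder (ρ : ℂ) : ℝ) * ‖weilMellin w ρ‖ ^ 2) (weilQuadratic w).re := by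
  have hQ : WeilConverse.zeroForm w = weilQuadratic w :=
    tendsto_nhds_unique (WeilConverse.hasWeilZeroSide_zeroForm hw)
      (explicit_formula_holds (hw.weilConv hw.weilReflect))
  have h1 := Complex.hasSum_re (WeilConverse.summable_pairCoeff hw).hasSum
  rw [← hQ]
  refine h1.congr_fun fun ρ ↦ ?_
  exact (re_order_mul_pairCoeff_eq_of_re_eq_half w (SoundTest.re_eq_half_of_RH hRH ρ)).symm

/-- Finite zero-side sums of squares of a test function are bounded by the form (under RH):
`Σ_{ρ ∈ S} m(ρ)|ŵ(ρ)|² ≤ Re Q(w)`. [folklore] -/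
theorem saturation_sum_le_re_weilQuadratic (hRH : RiemannHypothesis) {w : ℝ → ℂ}
    (hw : IsWeilTest w) (S : Finset ZetaZeros.riemannZetaNontrivialZeros) :
    ∑ ρ ∈ S, (riemannZetaZeroOrder (ρ : ℂ) : ℝ) * ‖weilMellin w ρ‖ ^ 2 ≤ (weilQuadratic w).re := by
  refine sum_le_hasSum S (fun ρ _ ↦ mul_nonneg ?_ (sq_nonneg _))
    (saturation_hasSum_of_isWeilTest hRH hw)
  exact_mod_cast riemannZetaZeroOrder_nonneg (ZetaZeros.riemannZetaNontrivialZeros.ne_one ρ.2)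

/-! ### Two elementary inequalities -/

/-- `|x|² ≤ (1 + η)|y|² + (1 + η⁻¹)|x - y|²` for `η > 0` (triangle inequality and
`2AB ≤ ηA² + η⁻¹B²`). [folklore] -/
theorem saturation_norm_sq_le (x y : ℂ) {η : ℝ} (hη : 0 < η) :
    ‖x‖ ^ 2 ≤ (1 + η) * ‖y‖ ^ 2 + (1 + η⁻¹) * ‖x - y‖ ^ 2 := by
  have h1 : ‖x‖ ≤ ‖y‖ + ‖x - y‖ := by
    have h := norm_add_le y (x - y)
    rwa [add_sub_cancel] at h
  have hA := norm_nonneg y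
  have hB := norm_nonneg (x - y)
  have h2 : ‖x‖ ^ 2 ≤ (‖y‖ + ‖x - y‖) ^ 2 := pow_le_pow_left₀ (norm_nonneg x) h1 2
  have h3 : 2 * ‖y‖ * ‖x - y‖ ≤ η * ‖y‖ ^ 2 + η⁻¹ * ‖x - y‖ ^ 2 := by
    have h4 : η * (2 * ‖y‖ * ‖x - y‖) ≤ η * (η * ‖y‖ ^ 2 + η⁻¹ * ‖x - y‖ ^ 2) := by
      have e : η * (η * ‖y‖ ^ 2 + η⁻¹ * ‖x - y‖ ^ 2) = (η * ‖y‖) ^ 2 + ‖x - y‖ ^ 2 := by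
        rw [mul_add, mul_inv_cancel_left₀ hη.ne']
        ring
      rw [e]
      nlinarith [sq_nonneg (η * ‖y‖ - ‖x - y‖)]
    exact le_of_mul_le_mul_left h4 hη
  nlinarith [h2, h3]

/-- If `e ≤ (1 + η) T + (1 + η⁻¹) δ` for all `η, δ > 0` (`T ≥ 0`), then `e ≤ T`. [folklore] -/
theorem saturation_le_of_forall {e T : ℝ} (hT : 0 ≤ T)
    (h : ∀ η : ℝ, 0 < η → ∀ δ : ℝ, 0 < δ → e ≤ (1 + η) * T + (1 + η⁻¹) * δ) : e ≤ T := by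
  refine le_of_forall_pos_le_add fun κ hκ ↦ ?_
  have h2T : 0 < 2 * T + 1 := by linarith
  obtain ⟨η, hη⟩ : ∃ η : ℝ, η = κ / (2 * T + 1) := ⟨_, rfl⟩
  have hη0 : 0 < η := by
    rw [hη]
    exact div_pos hκ h2T
  have hηT : η * T ≤ κ / 2 := by
    rw [hη, div_mul_eq_mul_div, div_le_div_iff₀ h2T two_pos]
    nlinarith
  have h1 : 0 < 1 + η⁻¹ := by positivity
  have h3 := h η hη0 (κ / 2 / (1 + η⁻¹)) (div_pos (half_pos hκ) h1)
  have e1 : (1 + η⁻¹) * (κ / 2 / (1 + η⁻¹)) = κ / 2 := by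
    field_simp
  rw [e1] at h3
  nlinarith

/-! ### The stub -/

/-- **Stub W4 — under RH the ground energy equals the zero-sampling sum of every ground state.**
For a ground state `u` at the window `a`, under the Riemann Hypothesis
`Σ_ρ m(ρ)|û(ρ)|² = ε(a)` (absolutely convergent): `≤` is the sampling inequality
`summable_order_mul_norm_sq_weilMellin_of_riemannHypothesis`; `≥` follows from the energy-Cauchy
property of the minimising sequence (`stub_energyCauchy`), the sum-of-squares form of the zero
side of test functions under RH (`saturation_hasSum_of_isWeilTest`), termwise convergence
`ĝₙ(ρ) → û(ρ)` (`ConnesVanSuijlekom.tendsto_weilMellin`) and the elementary inequality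
`|x|² ≤ (1 + η)|y|² + (1 + η⁻¹)|x - y|²` on finite sets of zeros. [folklore] -/
theorem stub_saturation_of_RH :
    RiemannHypothesis → ∀ (a : ℝ) (u : ℝ → ℂ), IsWeilGroundState a u →
      HasSum (fun ρ : ZetaZeros.riemannZetaNontrivialZeros =>
          (riemannZetaZeroOrder (ρ : ℂ) : ℝ) * ‖weilMellin u ρ‖ ^ 2) (weilGroundEnergy a) := by
  intro hRH a u hu
  obtain ⟨hs, hle⟩ := summable_order_mul_norm_sq_weilMellin_of_riemannHypothesis hRH hu
  obtain ⟨hmem, g, hg, hQ, hL⟩ := id hu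
  have hm0 : ∀ ρ : ZetaZeros.riemannZetaNontrivialZeros,
      (0 : ℝ) ≤ riemannZetaZeroOrder (ρ : ℂ) := fun ρ ↦ by
    exact_mod_cast riemannZetaZeroOrder_nonneg (ZetaZeros.riemannZetaNontrivialZeros.ne_one ρ.2)
  have hf0 : ∀ ρ : ZetaZeros.riemannZetaNontrivialZeros,
      0 ≤ (riemannZetaZeroOrder (ρ : ℂ) : ℝ) * ‖weilMellin u ρ‖ ^ 2 := fun ρ ↦
    mul_nonneg (hm0 ρ) (sq_nonneg _)
  have hT0 : 0 ≤ ∑' ρ : ZetaZeros.riemannZetaNontrivialZeros,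
      (riemannZetaZeroOrder (ρ : ℂ) : ℝ) * ‖weilMellin u ρ‖ ^ 2 := tsum_nonneg hf0
  -- it suffices to prove `ε(a) ≤ T`
  suffices hge : weilGroundEnergy a ≤ ∑' ρ : ZetaZeros.riemannZetaNontrivialZeros,
      (riemannZetaZeroOrder (ρ : ℂ) : ℝ) * ‖weilMellin u ρ‖ ^ 2 by
    rw [← le_antisymm hle hge]
    exact hs.hasSum
  -- termwise convergence `ĝₖ(ρ) → û(ρ)`
  have hconv : ∀ ρ : ZetaZeros.riemannZetaNontrivialZeros,
      Tendsto (fun k ↦ weilMellin (g k) ρ) atTop (𝓝 (weilMellin u ρ)) := fun ρ ↦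
    ConnesVanSuijlekom.tendsto_weilMellin hu (fun n ↦ ⟨(hg n).1, (hg n).2.1⟩) hL (ρ : ℂ)
  -- the minimising sequence is Cauchy in energy
  have hC := stub_energyCauchy a u g hmem hg hQ hL
  refine saturation_le_of_forall hT0 fun η hη δ hδ ↦ ?_
  obtain ⟨N, hN⟩ := eventually_atTop.1 (hC.eventually_lt_const hδ)
  have hη1 : 0 ≤ 1 + η⁻¹ := by positivity
  have hη2 : 0 ≤ 1 + η := by positivity
  -- the bound `Re Q(gₙ) ≤ (1 + η) T + (1 + η⁻¹) δ` for `n ≥ N.1`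
  have hbound : ∀ n, N.1 ≤ n →
      (weilQuadratic (g n)).re ≤ (1 + η) * (∑' ρ : ZetaZeros.riemannZetaNontrivialZeros,
        (riemannZetaZeroOrder (ρ : ℂ) : ℝ) * ‖weilMellin u ρ‖ ^ 2) + (1 + η⁻¹) * δ := by
    intro n hn
    -- `Σ_{ρ ∈ S} m(ρ)|ĝₙ(ρ) - û(ρ)|² ≤ δ` for every finite `S`
    have hdiff : ∀ S : Finset ZetaZeros.riemannZetaNontrivialZeros,
        ∑ ρ ∈ S, (riemannZetaZeroOrder (ρ : ℂ) : ℝ) *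
          ‖weilMellin (g n) ρ - weilMellin u ρ‖ ^ 2 ≤ δ := by
      intro S
      have hTm : Tendsto (fun k ↦ ∑ ρ ∈ S, (riemannZetaZeroOrder (ρ : ℂ) : ℝ) *
          ‖weilMellin (g n) ρ - weilMellin (g k) ρ‖ ^ 2) atTop
          (𝓝 (∑ ρ ∈ S, (riemannZetaZeroOrder (ρ : ℂ) : ℝ) *
            ‖weilMellin (g n) ρ - weilMellin u ρ‖ ^ 2)) := by
        refine tendsto_finsetSum S fun ρ _ ↦ ?_
        exact ((tendsto_const_nhds.sub (hconv ρ)).norm.pow 2).const_mul _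
      refine le_of_tendsto hTm ?_
      filter_upwards [eventually_ge_atTop N.2] with k hk
      have hlt : (weilQuadratic (g n - g k)).re < δ := hN (n, k) ⟨hn, hk⟩
      have h1 := saturation_sum_le_re_weilQuadratic hRH ((hg n).1.sub (hg k).1) S
      have h2 : ∑ ρ ∈ S, (riemannZetaZeroOrder (ρ : ℂ) : ℝ) *
          ‖weilMellin (g n) ρ - weilMellin (g k) ρ‖ ^ 2 =
          ∑ ρ ∈ S, (riemannZetaZeroOrder (ρ : ℂ) : ℝ) * ‖weilMellin (g n - g k) ρ‖ ^ 2 := by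
        refine Finset.sum_congr rfl fun ρ _ ↦ ?_
        rw [weilMellin_sub (hg n).1.1.continuous (hg n).1.2 (hg k).1.1.continuous (hg k).1.2]
      rw [h2]
      exact h1.trans hlt.le
    -- `Σ_{ρ ∈ S} m(ρ)|ĝₙ(ρ)|² ≤ (1 + η) T + (1 + η⁻¹) δ` for every finite `S`
    have hS : ∀ S : Finset ZetaZeros.riemannZetaNontrivialZeros,
        ∑ ρ ∈ S, (riemannZetaZeroOrder (ρ : ℂ) : ℝ) * ‖weilMellin (g n) ρ‖ ^ 2 ≤
          (1 + η) * (∑' ρ : ZetaZeros.riemannZetaNontrivialZeros,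
            (riemannZetaZeroOrder (ρ : ℂ) : ℝ) * ‖weilMellin u ρ‖ ^ 2) + (1 + η⁻¹) * δ := by
      intro S
      have h1 : ∑ ρ ∈ S, (riemannZetaZeroOrder (ρ : ℂ) : ℝ) * ‖weilMellin u ρ‖ ^ 2 ≤
          ∑' ρ : ZetaZeros.riemannZetaNontrivialZeros,
            (riemannZetaZeroOrder (ρ : ℂ) : ℝ) * ‖weilMellin u ρ‖ ^ 2 :=
        hs.sum_le_tsum S (fun ρ _ ↦ hf0 ρ)
      have h2 := hdiff S
      calc ∑ ρ ∈ S, (riemannZetaZeroOrder (ρ : ℂ) : ℝ) * ‖weilMellin (g n) ρ‖ ^ 2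
          ≤ ∑ ρ ∈ S, ((1 + η) * ((riemannZetaZeroOrder (ρ : ℂ) : ℝ) * ‖weilMellin u ρ‖ ^ 2) +
              (1 + η⁻¹) * ((riemannZetaZeroOrder (ρ : ℂ) : ℝ) *
                ‖weilMellin (g n) ρ - weilMellin u ρ‖ ^ 2)) := by
            refine Finset.sum_le_sum fun ρ _ ↦ ?_
            have h := mul_le_mul_of_nonneg_left
              (saturation_norm_sq_le (weilMellin (g n) ρ) (weilMellin u ρ) hη) (hm0 ρ)
            calc (riemannZetaZeroOrder (ρ : ℂ) : ℝ) * ‖weilMellin (g n) ρ‖ ^ 2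
                ≤ (riemannZetaZeroOrder (ρ : ℂ) : ℝ) * ((1 + η) * ‖weilMellin u ρ‖ ^ 2 +
                    (1 + η⁻¹) * ‖weilMellin (g n) ρ - weilMellin u ρ‖ ^ 2) := h
              _ = _ := by ring
        _ = (1 + η) * ∑ ρ ∈ S, (riemannZetaZeroOrder (ρ : ℂ) : ℝ) * ‖weilMellin u ρ‖ ^ 2 +
              (1 + η⁻¹) * ∑ ρ ∈ S, (riemannZetaZeroOrder (ρ : ℂ) : ℝ) *
                ‖weilMellin (g n) ρ - weilMellin u ρ‖ ^ 2 := by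
            rw [Finset.sum_add_distrib, Finset.mul_sum, Finset.mul_sum]
        _ ≤ _ := by gcongr
    exact hasSum_le_of_sum_le (saturation_hasSum_of_isWeilTest hRH (hg n).1) hS
  -- `n → ∞`
  exact le_of_tendsto hQ (eventually_atTop.2 ⟨N.1, hbound⟩)

end Summit.RiemannHypothesis.RiemannHypothesis.Theorems.GroundStatesConvergeToXi

end
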